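import Literature.MathematicalPhysics.QuantumFieldTheory.Balaban1983to89.Node00.StepWeightsOfRecord
import Literature.MathematicalPhysics.QuantumFieldTheory.Balaban1983to89.BlockAveragingTowerStraightTransportLocal
import Literature.MathematicalPhysics.QuantumFieldTheory.Balaban1983to89.B11GaugeGlue
import Literature.MathematicalPhysics.QuantumFieldTheory.Balaban1983to89.B15Prop1DatumSmall7AtZSequence

/-!
# DAG node N11 — THE (3.3) STEP OF THE SUPPORT CLAUSE, GENERIC: two level-`k` fields compared plaquette by plaquette through their bond quotients (any `GaugeGroup`),
# its reading under r11's `SmallApproxFluct` (3.3), and the geometry of the starred bond set `(□′^{∼2})^{(k)*}` pinned at the record — a level-`k` plaquette based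
# (through `ι_k`) in the χ-cube `□′` has its four bonds there

HEADER — WORK-UNIT METADATA.  Cell `pub-ymgap`, YM-PLAN Track A (HUMAN RULING D-0062), seat `pub-ymgap-dag-n08-w2` (g10; WIDTH SEAT 2∕4 on N08 [B10], RE-POINTED to
N11's [III] §3-supply residue), route `BalabanUVNodes`, key item K1⁷ `StabilityBAtRecordR13SepCoPH` = stmt-QuantumFields-20542 (helper lane, `--kind proof --supports 20542
--as helper` — jail key; K1⁹ stmt-QuantumFields-27364 is the K1-face of record, mis-key rule; count-neutral; (B4)-socket bookkeeping).  [III] = [Balaban1988Convergent],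
[I] = [Balaban1987RG1].  FILE 14 of this seat's kernel-level socket (the GENERIC half of CLAIM-1; its record-level half is FILE 15 `…N11TStepInnerCentralWindowChartAtRegionsOfSupport`).
Over def-T's `Node00/StepWeightsOfRecord` (`sect3DataOfRecord`: r11's (3.2)∕(3.3)∕(3.4) data PINNED at the record — `bondsStar □′` = the level-`k` bonds with both ends'
`ι_k`-images in `□′^{∼2}`; `sideχ`, `cubeχ`, `Iχ`), r11's `B14.Sect3Decomp` (`Sect3Data`, `Vbox` = (3.4) `V^{(k)}_{□′} = M^k(U_{k+1,□′})`, `SmallApproxFluct` = the (3.3) event), the tree's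
`BlockAveragingTowerStraightTransportLocal.dist1_mul_mul_inv_mul_le` (two-factor `dist1` telescoping from bi-invariance), `B11GaugeGlue.dist1_inv_mul_eq`, and n12-c's
`B15Prop1DatumSmall7AtZSequence.cover_add_single_pow` (a `T^{(k)}`-step on the cover).  CONSUMED BY NAME, nothing modified.

WHY THIS FILE.  The (B4) ∕ (O3′) roads of N11 display ONE support clause — «wherever def-T's step weight `w_k(s)(U,V′) ≠ 0`, the level-`k` loops ∕ plaquettes of `U` at the
blocks of the coarse bonds meeting `Ω_{k+1}(s)` are small» (dag-n11-w6 p629018, this seat's FILES 10–13), resp. «the central bond variables sit in their windows» (dag-n11-d,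
dag-n11-w2's `hbridge`).  dag-n11-w2 g4's p638096 `…N11StepWeightSupportOfRecord` unpacked the weight: `w ≠ 0` exhibits a label `t = (P,Q,R,S)` with (3.2) `PlaqSmallOn {p ⊂ □′^∼}
(ε_{k+1}η²) (U_{k+1,□′}(V′))` on `cubes32 ∖ P` and (3.3) `SmallApproxFluct … (2δ_k) U V′ □′` on `qcubes P ∖ Q`.  Between (3.3) and «small plaquettes of `U`» lie exactly two
elementary steps, proved HERE once and for all consumers: (§1) bond-by-bond closeness of two fields ⇒ plaquette-by-plaquette closeness (pure `GaugeGroup` algebra: `dist1 (U(∂q)·V(∂q)⁻¹)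
≤ Σ_{b∈∂q} dist1 (U(b)·V(b)⁻¹)`), hence under (3.3) `dist1 (U(∂q)) < dist1 (V^{(k)}_{□′}(V′)(∂q)) + 4·2δ_k` for plaquettes whose bonds lie in `(□′^{∼2})^{(k)*}`; (§2) a level-`k`
plaquette whose base point `ι_k(q₋)` lies in the χ-cube `□′` (side `L^{k+2}M₂R_{k+1} ≥ L^k`) HAS its four bonds in `(□′^{∼2})^{(k)*}` (its corners are `ι_k(q₋) + L^k(ε_μ e_μ + ε_ν e_ν)` on
the cover).  What then remains of the support clause is the BACKGROUND's business only: the level-`k` plaquettes of `V^{(k)}_{□′}(V′) = M^k(U_{k+1,□′}(V′))` — FILE 15.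

WHAT THIS FILE PROVES (0 `def`, 0 `sorry`, standard axioms).
§1 (any `GaugeGroup`, two fields, one plaquette) ★ `dist1_plaqHol_mul_inv_plaqHol_le` · `dist1_plaqHol_le_add_of_bonds` · (r11 `Sect3Data`-generic) ★ `dist1_plaqHol_lt_of_smallApproxFluct`.
§2 `add_single_mem_cubeExt` · ★ `bonds_mem_bondsStar_of_embIter_mem_cubeχ` (at def-T's pinned data `sect3DataOfRecord`, `0 < sideχ`).

HONEST FRAMING.  Helper lane of K1⁷ (aside key); count-neutral; group algebra and lattice bookkeeping over the tree's own objects; nothing of Bałaban asserted (no estimate, no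
regularity of minimisers, no Stokes bound, no chart); (B4)∕(S-α)∕(O3′) NOT closed; N11 NOT discharged; N08 untouched; K1⁷∕K1⁸∕K1⁹ NOT closed, no registered stub touched; counts
unmoved (typed 28∕28 · discharged 5∕27 · A 5∕28).  One finite `𝕋⁴_{L^K}` programme at fixed `ε = L^{−K}`; R4 closes only the conditional finite-𝕋⁴ rung `BalabanLadder.UV` — NOT ℝ⁴,
NOT OS, NOT a mass gap, NOT Clay.  No `sorry`, `axiom`, `def`, `instance`, `notation`.
Sources (SHAPE ∕ bookkeeping only): [III] (2.16)–(2.17) p.257, (3.3)–(3.4) p.265; [I] (0.1) p.251; [Balaban1985Averaging] (9) p.19, (19)–(20) p.21.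
-/

noncomputable section

namespace Summit.QuantumFields.YangMills.Theorems.BalabanUVNodesN11ApproxFluctPlaquetteComparison

open Literature.MathematicalPhysics.QuantumFieldTheory.Balaban1983to89
open Literature.MathematicalPhysics.QuantumFieldTheory.Balaban1983to89.BlockAveragingTowerStraightTransportLocal (dist1_mul_mul_inv_mul_le)
open Literature.MathematicalPhysics.QuantumFieldTheory.Balaban1983to89.B11GaugeGlue (dist1_inv_mul_eq)
open Literature.MathematicalPhysics.QuantumFieldTheory.Balaban1983to89.B14.Sect3Decomp (Sect3Data Vbox SmallApproxFluct)
open Literature.MathematicalPhysics.QuantumFieldTheory.Balaban1983to89.B15DeterminingSets (embIter)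
open Literature.MathematicalPhysics.QuantumFieldTheory.Balaban1983to89.B15Eq112TorusCover (cover)
open Literature.MathematicalPhysics.QuantumFieldTheory.Balaban1983to89.B14.Eq213MaximalDomains (cubeExt)
open Literature.MathematicalPhysics.QuantumFieldTheory.Balaban1983to89.B14DomainGeom (Pt)
open Literature.MathematicalPhysics.QuantumFieldTheory.Balaban1983to89.B15Prop1DatumSmall7AtZSequence (cover_add_single_pow)
open Node00 hiding SU
open T4Continuum

/-! ## §1  Two fields, one plaquette: the four-bond `dist1` telescoping, and its (3.3) reading -/

section Telescoping

variable {P : Params} {G : Type*} [GaugeGroup G] {j : ℕ}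

/-- ★ **TWO FIELDS, ONE PLAQUETTE**: `dist1 (U(∂q)·V(∂q)⁻¹) ≤ Σ_{b ∈ ∂q} dist1 (U(b)·V(b)⁻¹)` — the plaquette variables (9) of two level-`j` configurations compared bond by bond
through the bi-invariance (19)–(20) of the distance (three applications of the two-factor telescoping `dist1 (a b (a′b′)⁻¹) ≤ dist1 (a a′⁻¹) + dist1 (b b′⁻¹)` and pv's
`B11GaugeGlue.dist1_inv_mul_eq` for the two inverted letters).
[cite: Balaban1985Averaging, (9) p.19, (19)-(20) p.21] -/
theorem dist1_plaqHol_mul_inv_plaqHol_le (U V : GaugeField P j G) (q : Plaq P j) :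
    dist1 (GaugeField.plaqHol U q * (GaugeField.plaqHol V q)⁻¹) ≤
      dist1 (U ⟨q.src, q.μ⟩ * (V ⟨q.src, q.μ⟩)⁻¹) + dist1 (U ⟨q.src.shift q.μ, q.ν⟩ * (V ⟨q.src.shift q.μ, q.ν⟩)⁻¹) +
        dist1 (U ⟨q.src.shift q.ν, q.μ⟩ * (V ⟨q.src.shift q.ν, q.μ⟩)⁻¹) + dist1 (U ⟨q.src, q.ν⟩ * (V ⟨q.src, q.ν⟩)⁻¹) := by
  unfold GaugeField.plaqHol
  have h₁ := dist1_mul_mul_inv_mul_le (U ⟨q.src, q.μ⟩ * U ⟨q.src.shift q.μ, q.ν⟩ * (U ⟨q.src.shift q.ν, q.μ⟩)⁻¹) (U ⟨q.src, q.ν⟩)⁻¹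
    (V ⟨q.src, q.μ⟩ * V ⟨q.src.shift q.μ, q.ν⟩ * (V ⟨q.src.shift q.ν, q.μ⟩)⁻¹) (V ⟨q.src, q.ν⟩)⁻¹
  have h₂ := dist1_mul_mul_inv_mul_le (U ⟨q.src, q.μ⟩ * U ⟨q.src.shift q.μ, q.ν⟩) (U ⟨q.src.shift q.ν, q.μ⟩)⁻¹
    (V ⟨q.src, q.μ⟩ * V ⟨q.src.shift q.μ, q.ν⟩) (V ⟨q.src.shift q.ν, q.μ⟩)⁻¹
  have h₃ := dist1_mul_mul_inv_mul_le (U ⟨q.src, q.μ⟩) (U ⟨q.src.shift q.μ, q.ν⟩) (V ⟨q.src, q.μ⟩) (V ⟨q.src.shift q.μ, q.ν⟩)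
  rw [inv_inv, dist1_inv_mul_eq] at h₁ h₂
  linarith

/-- **COROLLARY**: `dist1 (U(∂q)) ≤ dist1 (V(∂q)) + Σ_{b ∈ ∂q} dist1 (U(b)·V(b)⁻¹)`. [cite: Balaban1985Averaging, (9) p.19, (19)-(20) p.21] -/
theorem dist1_plaqHol_le_add_of_bonds (U V : GaugeField P j G) (q : Plaq P j) :
    dist1 (GaugeField.plaqHol U q) ≤ dist1 (GaugeField.plaqHol V q) +
      (dist1 (U ⟨q.src, q.μ⟩ * (V ⟨q.src, q.μ⟩)⁻¹) + dist1 (U ⟨q.src.shift q.μ, q.ν⟩ * (V ⟨q.src.shift q.μ, q.ν⟩)⁻¹) +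
        dist1 (U ⟨q.src.shift q.ν, q.μ⟩ * (V ⟨q.src.shift q.ν, q.μ⟩)⁻¹) + dist1 (U ⟨q.src, q.ν⟩ * (V ⟨q.src, q.ν⟩)⁻¹)) := by
  have h := GaugeGroup.dist1_mul_le (GaugeField.plaqHol U q * (GaugeField.plaqHol V q)⁻¹) (GaugeField.plaqHol V q)
  rw [inv_mul_cancel_right] at h
  have h' := dist1_plaqHol_mul_inv_plaqHol_le U V q
  linarith

/-- ★ **THE (3.3) READING**: if the level-`k` field `V_k` has small approximate fluctuations on the χ-cube `□′` (r11's `SmallApproxFluct D av 2δ V_k V □′`: `dist1 (V_k(b)·V^{(k)}_{□′}(b)⁻¹) < 2δ`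
for every `b ∈ (□′^{∼2})^{(k)*} = D.bondsStar □′`, `V^{(k)}_{□′} = M^k(U_{k+1,□′}(V))` = `Vbox D av □′ V`), the four bonds of the plaquette `q` lie in `D.bondsStar □′`, and the
background plaquette is within `a` of `1`, then `dist1 (V_k(∂q)) < a + 4·2δ`. [cite: Balaban1988Convergent, (3.3)–(3.4) p.265; Balaban1985Averaging, (19)-(20) p.21] -/
theorem dist1_plaqHol_lt_of_smallApproxFluct {k : ℕ} (D : Sect3Data P G k) (av : ∀ j, Averaging P j G) {twoδ a : ℝ} {Vk : GaugeField P k G}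
    {V : GaugeField P (k + 1) G} {c : D.Cube1} (h : SmallApproxFluct D av twoδ Vk V c) (q : Plaq P k)
    (h₁ : (⟨q.src, q.μ⟩ : PBond P k) ∈ D.bondsStar c) (h₂ : (⟨q.src.shift q.μ, q.ν⟩ : PBond P k) ∈ D.bondsStar c)
    (h₃ : (⟨q.src.shift q.ν, q.μ⟩ : PBond P k) ∈ D.bondsStar c) (h₄ : (⟨q.src, q.ν⟩ : PBond P k) ∈ D.bondsStar c)
    (ha : dist1 (GaugeField.plaqHol (Vbox D av c V) q) ≤ a) :
    dist1 (GaugeField.plaqHol Vk q) < a + 4 * twoδ := by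
  have hq := dist1_plaqHol_le_add_of_bonds Vk (Vbox D av c V) q
  have e₁ := h _ h₁
  have e₂ := h _ h₂
  have e₃ := h _ h₃
  have e₄ := h _ h₄
  linarith

end Telescoping

/-! ## §2  Geometry of r11's starred bond set at the record: a level-`k` plaquette based (through `ι_k`) in the χ-cube `□′` has its four bonds in `(□′^{∼2})^{(k)*}` -/

section Geometry

variable {P : Params}

/-- One step of size `t ≥ 0` in one coordinate widens the collar by `t`. [cite: Balaban1988Convergent, (2.16)–(2.17) p.257 (bookkeeping)] -/
theorem add_single_mem_cubeExt {S : ℕ} {a z : Pt P.d} {w t : ℤ} (hz : z ∈ cubeExt S a w) (ht : 0 ≤ t) (μ : Fin P.d) :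
    z + Pi.single μ t ∈ cubeExt S a (w + t) := by
  intro i
  obtain ⟨h1, h2⟩ := hz i
  by_cases hi : i = μ
  · subst hi; simp only [Pi.add_apply, Pi.single_eq_same]; constructor <;> linarith
  · simp only [Pi.add_apply, Pi.single_eq_of_ne hi, add_zero]; constructor <;> linarith

variable {F : T4Family} {N : ℕ} [NeZero N] (ν : Stage7Numerics) (M : ℕ) (p : B12.RunParams) (g : ℕ → ℝ) {k : ℕ}

/-- ★ **THE FOUR BONDS OF A LEVEL-`k` PLAQUETTE BASED IN `□′` LIE IN `(□′^{∼2})^{(k)*}`**: if `ι_k(q₋) ∈ □′` (the χ-cube of side `S = L^{k+2}M₂R_{k+1} > 0` fine sites) then the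
images `ι_k` of both ends of each of the four bonds of `∂q` lie in `□′^{∼2}` — they are `ι_k(q₋) + L^k(ε_μ e_μ + ε_ν e_ν)`, `ε ∈ {0,1}` on the cover (`cover_add_single_pow`), and
`2·L^k ≤ 2·S`; so the bonds belong to r11's `bondsStar □′` pinned at the record (`sect3DataOfRecord`: both ends' `ι_k`-images in `cubeEnl □′ 2`).
[cite: Balaban1988Convergent, (3.3) p.265, (2.16)–(2.17) p.257; Balaban1987RG1, (0.1) p.251] -/
theorem bonds_mem_bondsStar_of_embIter_mem_cubeχ (hS : 0 < sideχ F ν p g k) (s : SeqOfRecord F ν M g p.K k) (c : Iχ F ν p g k) (q : Plaq (F.P p.K) k)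
    (hq : embIter k q.src ∈ cubeχ F ν p g k c) :
    (⟨q.src, q.μ⟩ : PBond (F.P p.K) k) ∈ (sect3DataOfRecord F N ν M p g k s).bondsStar c ∧
      (⟨q.src.shift q.μ, q.ν⟩ : PBond (F.P p.K) k) ∈ (sect3DataOfRecord F N ν M p g k s).bondsStar c ∧
      (⟨q.src.shift q.ν, q.μ⟩ : PBond (F.P p.K) k) ∈ (sect3DataOfRecord F N ν M p g k s).bondsStar c ∧
      (⟨q.src, q.ν⟩ : PBond (F.P p.K) k) ∈ (sect3DataOfRecord F N ν M p g k s).bondsStar c := by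
  classical
  obtain ⟨x, hx, hxe⟩ := hq
  have hL : (0 : ℤ) ≤ ((((F.P p.K).L ^ k : ℕ)) : ℤ) := by positivity
  -- `L^k ≤ S`: `S = L^{k+2}·M₂·R > 0`
  have hLS : (F.P p.K).L ^ k ≤ sideχ F ν p g k := by
    have h0 := hS
    unfold sideχ cubeSide at h0 ⊢
    have hMR : 1 ≤ ν.M₂ * RkOfRecord (F.P p.K).L ν.r (g (k + 1)) := by
      rcases Nat.eq_zero_or_pos (ν.M₂ * RkOfRecord (F.P p.K).L ν.r (g (k + 1))) with h | h
      · rw [mul_assoc, h, mul_zero] at h0; exact absurd h0 (lt_irrefl 0)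
      · exact h
    have hL1 : 1 ≤ (F.P p.K).L := by
      rcases Nat.eq_zero_or_pos (F.P p.K).L with h | h
      · rw [h, pow_succ, mul_zero, zero_mul, zero_mul] at h0; exact absurd h0 (lt_irrefl 0)
      · exact h
    calc (F.P p.K).L ^ k = (F.P p.K).L ^ k * 1 * 1 := by ring
      _ ≤ (F.P p.K).L ^ k * (F.P p.K).L ^ 2 * (ν.M₂ * RkOfRecord (F.P p.K).L ν.r (g (k + 1))) :=
          Nat.mul_le_mul (Nat.mul_le_mul_left _ (Nat.one_le_pow _ _ hL1)) hMR
      _ = (F.P p.K).L ^ (k + 1 + 1) * ν.M₂ * RkOfRecord (F.P p.K).L ν.r (g (k + 1)) := by ring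
  have hLS' : ((((F.P p.K).L ^ k : ℕ)) : ℤ) ≤ (sideχ F ν p g k : ℤ) := by exact_mod_cast hLS
  -- every point `x + L^k(ε_μ e_μ + ε_ν e_ν)` lies in the `2`-collar
  have hmem : ∀ z : Pt (F.P p.K).d, z ∈ cubeExt (sideχ F ν p g k) (c : Pt (F.P p.K).d) ((0 : ℤ) + (((F.P p.K).L ^ k : ℕ) : ℤ) + (((F.P p.K).L ^ k : ℕ) : ℤ)) →
      cover (F.P p.K) z ∈ cubeEnl (F.P p.K) (sideχ F ν p g k) c 2 := by
    intro z hz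
    refine ⟨z, fun i => ?_, rfl⟩
    obtain ⟨h1, h2⟩ := hz i
    have e2 : (((2 * sideχ F ν p g k : ℕ)) : ℤ) = 2 * (sideχ F ν p g k : ℤ) := by push_cast; ring
    rw [e2]; constructor <;> linarith
  have hx0 : x ∈ cubeExt (sideχ F ν p g k) (c : Pt (F.P p.K).d) (0 : ℤ) := by
    intro i; obtain ⟨h1, h2⟩ := hx i; simp only [Nat.zero_mul, Nat.cast_zero] at h1 h2; exact ⟨h1, h2⟩
  have hw : ∀ {w : ℤ} {z : Pt (F.P p.K).d}, z ∈ cubeExt (sideχ F ν p g k) (c : Pt (F.P p.K).d) w → z ∈ cubeExt (sideχ F ν p g k) (c : Pt (F.P p.K).d) (w + (((F.P p.K).L ^ k : ℕ) : ℤ)) := by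
    intro w z hz i; obtain ⟨h1, h2⟩ := hz i; constructor <;> linarith
  -- the five corner points on the cover
  have e₀ : cover (F.P p.K) x = embIter k q.src := hxe
  have eμ := cover_add_single_pow k e₀ q.μ
  have eν := cover_add_single_pow k e₀ q.ν
  have eμν := cover_add_single_pow k eμ q.ν
  have eνμ := cover_add_single_pow k eν q.μ
  have m₀ : embIter k q.src ∈ cubeEnl (F.P p.K) (sideχ F ν p g k) c 2 := e₀ ▸ hmem _ (hw (hw hx0))
  have mμ : embIter k (q.src.shift q.μ) ∈ cubeEnl (F.P p.K) (sideχ F ν p g k) c 2 := eμ ▸ hmem _ (hw (add_single_mem_cubeExt hx0 hL q.μ))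
  have mν : embIter k (q.src.shift q.ν) ∈ cubeEnl (F.P p.K) (sideχ F ν p g k) c 2 := eν ▸ hmem _ (hw (add_single_mem_cubeExt hx0 hL q.ν))
  have mμν : embIter k ((q.src.shift q.μ).shift q.ν) ∈ cubeEnl (F.P p.K) (sideχ F ν p g k) c 2 :=
    eμν ▸ hmem _ (add_single_mem_cubeExt (add_single_mem_cubeExt hx0 hL q.μ) hL q.ν)
  have mνμ : embIter k ((q.src.shift q.ν).shift q.μ) ∈ cubeEnl (F.P p.K) (sideχ F ν p g k) c 2 :=
    eνμ ▸ hmem _ (add_single_mem_cubeExt (add_single_mem_cubeExt hx0 hL q.ν) hL q.μ)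
  simp only [sect3DataOfRecord, Finset.mem_filter, Finset.mem_univ, true_and, PBond.tgt]
  exact ⟨⟨m₀, mμ⟩, ⟨mμ, mμν⟩, ⟨mν, mνμ⟩, ⟨m₀, mν⟩⟩

end Geometry

end Summit.QuantumFields.YangMills.Theorems.BalabanUVNodesN11ApproxFluctPlaquetteComparison

end
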